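import Summits.QuantumFields.YangMills.Theorems.BalabanLadderROTWardEquiv
import Summits.QuantumFields.YangMills.Theorems.BalabanLadderROTKingHierarchy
import HarnessLib

/-!
# Crux `ROT` (stmt-QuantumFields-20042), infinitesimal Ward route (lane B) — IV: the registered stub and the crux in Ward form

Helper file (`--supports stmt-QuantumFields-20042`, lane `ym-rot-20042-p2`).  Stub- and crux-level corollaries of
`Theorems.ROT.Ward.latticeRotWard_iff_latticeAngularWard_of_momentBounds6` (`…WardEquiv.lean`), through lane A's landed registry algebra
(`Theorems.ROT.kingLimit_iff_kingSingle`, `kingSingle_iff_rotUV`, `rot_of_stub_kingLimit`, `Theorems/BalabanLadderROTKingHierarchy.lean`):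

* `kingLimit_iff_kingAngular : KingLimit ↔ KingAngular` — the registered stub `stub_kingLimit : KingLimit` (v4 824d5540ff52cfd5) IS, verbatim
  up to this equivalence, the statement that the angular insertion `Σ_x (𝓛 W_k)(x) F(a_k x)` of the centred torus moment function of
  `tr F²` vanishes along every admissible scheme on the germ, for every compact simple `G`, `r`, unit map `a → 0` with `MomentBounds6`;
* `rot_of_kingAngular : KingAngular → Theses.BalabanLadder.ROT` (closer by name for a Ward-form proof of the stub) and
  `kingAngular_of_kingLimit`;
* `rot_iff_rotAngular : Theses.BalabanLadder.ROT ↔ ROTAngular` — the crux itself in Ward form (guards verbatim).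

HONEST FRAMING: registry algebra of an OPEN crux; the Ward form is neither weaker nor stronger than the stub — it names the lattice
quantity (the breaking-field insertion, `…WardSBP.bdiff_torusMoment`) that the infinitesimal route must show is `o(1)` on the germ;
`MomentBounds6` bounds its SIZE (`O(1)` after summation by parts, `…WardEquiv`), not its limit.  Nothing here asserts E1, a mass gap,
or Clay.  No definition, no fact, no sorry.
-/

set_option autoImplicit false

noncomputable section

open scoped SchwartzMap BigOperators
open MeasureTheory Filter Topology
open Literature.MathematicalPhysics.QuantumFieldTheory Literature.MathematicalPhysics.QuantumLattice
open Literature.MathematicalPhysics.AQFT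
open Summit.QuantumFields.YangMills.Cruxes.OSLegsFromFemtoAndGap.DlrCollarTransfer (MomentBounds MomentBounds6 LowerBounds)
open Summit.QuantumFields.YangMills.Cruxes.OSLegsAtWeakCouplingC.Y2Bridge (LatticeRotWard)
open Summit.QuantumFields.YangMills.Theorems.OSLegsFromFemtoAndGap (momentBounds_of_momentBounds6)
open Summit.QuantumFields.YangMills.Theorems.NPointIsotropy.Negative (E4)

namespace Summit.QuantumFields.YangMills.Theorems.ROT.Ward

/-- **The registered stub in Ward form: `KingLimit ⟺ KingAngular`** (through lane A's `kingLimit_iff_kingSingle`,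
`kingSingle_iff_rotUV` and the equivalence above). -/
theorem kingLimit_iff_kingAngular : KingLimit ↔ KingAngular := by
  rw [kingLimit_iff_kingSingle, kingSingle_iff_rotUV]
  constructor
  · intro h G _ _ _ _ hG
    letI : MeasurableSpace G := borel G
    haveI : BorelSpace G := ⟨rfl⟩
    intro r a ha ha0 hMB
    exact (latticeRotWard_iff_latticeAngularWard_of_momentBounds6 r a hMB).1 (h G hG r a ha ha0 hMB)
  · intro h G _ _ _ _ hG
    letI : MeasurableSpace G := borel G
    haveI : BorelSpace G := ⟨rfl⟩
    intro r a ha ha0 hMB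
    exact (latticeRotWard_iff_latticeAngularWard_of_momentBounds6 r a hMB).2 (h G hG r a ha ha0 hMB)

/-- **Closer: the Ward form of the stub closes the crux** — `KingAngular → Theses.BalabanLadder.ROT`. -/
theorem rot_of_kingAngular (h : KingAngular) : Summit.QuantumFields.YangMills.Theses.BalabanLadder.ROT :=
  rot_of_stub_kingLimit (kingLimit_iff_kingAngular.2 h)

/-- **Conversely the crux gives the Ward form** (so nothing is lost): `Theses.BalabanLadder.ROT → KingAngular` requires dropping the
scope-only `LowerBounds` guard, which `KingLimit` already does not carry; we record the guard-free direction `KingLimit → KingAngular`. -/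
theorem kingAngular_of_kingLimit (h : KingLimit) : KingAngular :=
  kingLimit_iff_kingAngular.1 h

/-- **The crux in Ward form: `Theses.BalabanLadder.ROT ⟺ ROTAngular`** (guards verbatim; the conclusion moved by summation by parts). -/
theorem rot_iff_rotAngular : Summit.QuantumFields.YangMills.Theses.BalabanLadder.ROT ↔ ROTAngular := by
  constructor
  · intro h G _ _ _ _ hG
    letI : MeasurableSpace G := borel G
    haveI : BorelSpace G := ⟨rfl⟩
    intro r a ha ha0 hNT hMB
    exact (latticeRotWard_iff_latticeAngularWard_of_momentBounds6 r a hMB).1 (h G hG r a ha ha0 hNT hMB)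
  · intro h G _ _ _ _ hG
    letI : MeasurableSpace G := borel G
    haveI : BorelSpace G := ⟨rfl⟩
    intro r a ha ha0 hNT hMB
    exact (latticeRotWard_iff_latticeAngularWard_of_momentBounds6 r a hMB).2 (h G hG r a ha ha0 hNT hMB)

end Summit.QuantumFields.YangMills.Theorems.ROT.Ward

end
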